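import Mathlib.Tactic
import HarnessLib
import HarnessLib.Audit.Tags
import Summits.CriticalPhenomena.PercolationContinuityZ3.Theorems.PercNearOneGluingNoHeavyLowerTailSahiAntichainSplitSunflower

/-!
# Antichains, meets plus joins: a three-member side always creates a new label

Support file (seat `prim-masterthm-p1`, gen 37; `--supports stmt-CriticalPhenomena-4575`).  No `sorry`, no new definitions, standard
axioms.  Memo `run/shared/lean/prim/prim-masterthm/FROM-prim-masterthm-p1-g37-LINEAR-REDUCTION.md` §2 (lemma U3).

SETTING (files `…SahiAntichainSplit*`): at a point `r`, `above P r` / `below P r` are the members containing / avoiding `r`;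
`newLabels P r = #newMeets P r + #newJoins P r` counts the cross meets that are not meets of two members below and the cross joins that
are not joins of two members above; `f P = f (above) + f (below) + newLabels P r`.

NEW HERE ([this work], gen 37).  **If exactly three members contain `r` (and some member avoids `r`), then `newLabels P r ≥ 1`**
(`newLabels_pos_of_card_above_eq_three`; dually `…_below_eq_three`).  This is the shape lemma «U3» of the threshold reduction
(`…SahiAntichainLinear`): a three-member side `A` opposite a side with at least seven members must satisfy `6 ≤ f A + newLabels`; by the
trichotomy of `…SplitSix` either `A` is a (co)sunflower (then `newLabels ≥ 2`, kernel) or `f A ≥ 5`, and then one new label suffices.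
PROOF.  Suppose no label is new and let `above = {c, c', d}`.  Every join of two distinct members above contains `c ∩ c'` (one of the two
is `c` or `c'`).  Pick `b` below; the cross meet `d ∩ b` is old, `= e ∩ e'` with `e ≠ e'` below; the cross joins `d ∪ e`, `d ∪ e'` are old,
hence contain `c ∩ c'`; so a point of `c ∩ c'` outside `d` would lie in `e` and `e'`, i.e. in `e ∩ e' = d ∩ b ⊆ d` — absurd.  Hence
`c ∩ c' ⊆ d` for every labelling of the three members, the three pairwise meets coincide, `above` is a sunflower, and the sunflower step
(`two_le_newLabels_of_above_sunflower`) produces two new labels after all.  Exhaustive data (`2^6`): a three-member side has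
`newLabels ≥ 2`, and `≥ 3` unless it is a sunflower facing a co-sunflower-like side.
HONEST FRAMING: unconditional; V5 itself remains OPEN. [this work]
-/

namespace Summit.CriticalPhenomena.PercolationContinuityZ3.Theorems.SahiColouredDaykin

open Finset

variable {α : Type*} [DecidableEq α]

/-- With no new label at `r`, every cross meet is a meet of two members below `r`. [this work] -/
theorem crossMeets_subset_meets_of_newLabels_eq_zero {P : Finset (Finset α)} {r : α} (h0 : newLabels P r = 0) :
    crossMeets P r ⊆ meets (below P r) := by
  unfold newLabels at h0
  have h : #(newMeets P r) = 0 := by omega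
  rw [card_eq_zero] at h
  unfold newMeets at h
  exact sdiff_eq_empty_iff_subset.1 h

/-- With no new label at `r`, every cross join is a join of two members above `r`. [this work] -/
theorem crossJoins_subset_joins_of_newLabels_eq_zero {P : Finset (Finset α)} {r : α} (h0 : newLabels P r = 0) :
    crossJoins P r ⊆ joins (above P r) := by
  unfold newLabels at h0
  have h : #(newJoins P r) = 0 := by omega
  rw [card_eq_zero] at h
  unfold newJoins at h
  exact sdiff_eq_empty_iff_subset.1 h

/-- **Key step.**  If no label is new at `r`, and `Z` is a set contained in every join of two distinct members above `r`, then `Z` is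
contained in every member `d` above `r`: the old cross meet `d ∩ b = e ∩ e'` and the old cross joins `d ∪ e`, `d ∪ e'` force
`Z \ d ⊆ e ∩ e' ⊆ d`. [this work] -/
theorem subset_of_subset_joins_of_newLabels_eq_zero {P : Finset (Finset α)} {r : α} {Z d : Finset α}
    (h0 : newLabels P r = 0) (hZ : ∀ W ∈ joins (above P r), Z ⊆ W) (hd : d ∈ above P r) (hB : (below P r).Nonempty) :
    Z ⊆ d := by
  obtain ⟨b, hb⟩ := hB
  obtain ⟨hdP, hrd⟩ := mem_above_iff.1 hd
  obtain ⟨hbP, hrb⟩ := mem_below_iff.1 hb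
  have hX := crossMeets_subset_meets_of_newLabels_eq_zero h0
  have hY := crossJoins_subset_joins_of_newLabels_eq_zero h0
  -- the cross meet `d ∩ b` is old
  have ht : d ∩ b ∈ meets (below P r) := hX (mem_crossMeets_iff.2 ⟨d, hdP, b, hbP, hrd, hrb, rfl⟩)
  obtain ⟨e, he, e', he', _, hee'⟩ := mem_meets_iff.1 ht
  obtain ⟨heP, hre⟩ := mem_below_iff.1 he
  obtain ⟨he'P, hre'⟩ := mem_below_iff.1 he'
  -- the cross joins `d ∪ e`, `d ∪ e'` are old, hence contain `Z`
  have hZe : Z ⊆ d ∪ e := hZ _ (hY (mem_crossJoins_iff.2 ⟨d, hdP, e, heP, hrd, hre, rfl⟩))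
  have hZe' : Z ⊆ d ∪ e' := hZ _ (hY (mem_crossJoins_iff.2 ⟨d, hdP, e', he'P, hrd, hre', rfl⟩))
  intro z hz
  by_contra hzd
  have hze : z ∈ e := by
    rcases mem_union.1 (hZe hz) with h | h
    · exact absurd h hzd
    · exact h
  have hze' : z ∈ e' := by
    rcases mem_union.1 (hZe' hz) with h | h
    · exact absurd h hzd
    · exact h
  have : z ∈ d ∩ b := by rw [hee']; exact mem_inter.2 ⟨hze, hze'⟩
  exact hzd (mem_inter.1 this).1

/-- In a three-member family `{x, y, z}`, every join of two distinct members contains `x ∩ y`. [this work] -/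
theorem inter_subset_of_mem_joins_three {A : Finset (Finset α)} {x y z W : Finset α}
    (hmem : ∀ a ∈ A, a = x ∨ a = y ∨ a = z) (hW : W ∈ joins A) : x ∩ y ⊆ W := by
  obtain ⟨a, ha, a', ha', haa', rfl⟩ := mem_joins_iff.1 hW
  have hx : x ∩ y ⊆ x := inter_subset_left
  have hy : x ∩ y ⊆ y := inter_subset_right
  rcases hmem a ha with rfl | rfl | rfl
  · exact hx.trans subset_union_left
  · exact hy.trans subset_union_left
  · rcases hmem a' ha' with rfl | rfl | rfl
    · exact hx.trans subset_union_right
    · exact hy.trans subset_union_right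
    · exact absurd rfl haa'

/-- **A three-member side creates a new label.**  If exactly three members of an antichain contain `r` and some member avoids `r`,
then `newLabels P r ≥ 1`. [this work] -/
theorem newLabels_pos_of_card_above_eq_three {P : Finset (Finset α)} {r : α}
    (hanti : IsAntichain (· ⊆ ·) (P : Set (Finset α))) (h3 : #(above P r) = 3) (hB : (below P r).Nonempty) :
    1 ≤ newLabels P r := by
  by_contra hlt
  have h0 : newLabels P r = 0 := by omega
  obtain ⟨a1, a2, a3, h12, h13, h23, hA⟩ := card_eq_three.1 h3
  have mem : ∀ a ∈ above P r, a = a1 ∨ a = a2 ∨ a = a3 := by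
    intro a ha
    rw [hA, mem_insert, mem_insert, mem_singleton] at ha
    exact ha
  have ha1 : a1 ∈ above P r := by rw [hA]; simp
  have ha2 : a2 ∈ above P r := by rw [hA]; simp
  have ha3 : a3 ∈ above P r := by rw [hA]; simp
  -- each pairwise meet lies in the third member
  have s12 : a1 ∩ a2 ⊆ a3 := subset_of_subset_joins_of_newLabels_eq_zero h0
    (fun W hW => inter_subset_of_mem_joins_three mem hW) ha3 hB
  have s13 : a1 ∩ a3 ⊆ a2 := subset_of_subset_joins_of_newLabels_eq_zero h0
    (fun W hW => inter_subset_of_mem_joins_three (x := a1) (y := a3) (z := a2)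
      (fun a ha => by rcases mem a ha with h | h | h <;> simp [h]) hW) ha2 hB
  have s23 : a2 ∩ a3 ⊆ a1 := subset_of_subset_joins_of_newLabels_eq_zero h0
    (fun W hW => inter_subset_of_mem_joins_three (x := a2) (y := a3) (z := a1)
      (fun a ha => by rcases mem a ha with h | h | h <;> simp [h]) hW) ha1 hB
  -- hence all pairwise meets coincide: `above` is a sunflower with kernel `a1 ∩ a2`
  have e13 : a1 ∩ a3 = a1 ∩ a2 :=
    Subset.antisymm (subset_inter inter_subset_left s13) (subset_inter inter_subset_left s12)
  have e23 : a2 ∩ a3 = a1 ∩ a2 :=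
    Subset.antisymm (subset_inter s23 inter_subset_left) (subset_inter inter_subset_right s12)
  have hK : ∀ a ∈ above P r, ∀ a' ∈ above P r, a ≠ a' → a ∩ a' = a1 ∩ a2 := by
    intro a ha a' ha' hne
    rcases mem a ha with rfl | rfl | rfl <;> rcases mem a' ha' with rfl | rfl | rfl
    · exact absurd rfl hne
    · rfl
    · exact e13
    · exact inter_comm _ _
    · exact absurd rfl hne
    · exact e23
    · rw [inter_comm]; exact e13
    · rw [inter_comm]; exact e23
    · exact absurd rfl hne
  have h2 := two_le_newLabels_of_above_sunflower hanti (by omega) hB hK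
  omega

/-- **Dually: a three-member side below creates a new label** (complementation, `…SahiAntichainDual`). [this work] -/
theorem newLabels_pos_of_card_below_eq_three {P : Finset (Finset α)} {r : α}
    (hanti : IsAntichain (· ⊆ ·) (P : Set (Finset α))) (h3 : #(below P r) = 3) (hA : (above P r).Nonempty) :
    1 ≤ newLabels P r := by
  set F := insert r (P.sup id) with hF
  have hP : ∀ a ∈ P, a ⊆ F := subset_insert_sup P r
  have hr : r ∈ F := mem_insert_self _ _
  rw [← newLabels_image_compl hP hr]
  refine newLabels_pos_of_card_above_eq_three (isAntichain_image_compl hanti hP)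
    (by rw [card_above_image_compl hP hr]; exact h3) ?_
  rw [below_image_compl (P := P) hr]
  exact hA.image _

/-- The U3 shape lemma in the form used by the threshold reduction: a three-member side `A = above P r` with at least five labels of its
own satisfies `2 · 3 ≤ f A + newLabels P r`. [this work] -/
theorem six_le_of_card_above_eq_three {P : Finset (Finset α)} {r : α}
    (hanti : IsAntichain (· ⊆ ·) (P : Set (Finset α))) (h3 : #(above P r) = 3) (hB : (below P r).Nonempty)
    (h5 : 5 ≤ #(meets (above P r)) + #(joins (above P r))) :
    6 ≤ #(meets (above P r)) + #(joins (above P r)) + newLabels P r := by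
  have := newLabels_pos_of_card_above_eq_three hanti h3 hB
  omega

end Summit.CriticalPhenomena.PercolationContinuityZ3.Theorems.SahiColouredDaykin
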